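import Mathlib
import Summits.QuantumFields.YangMills.Theorems.CoarseStiffnessTailCappedCoarseStiffnessLUniformMeanAction
import Summits.QuantumFields.YangMills.Theorems.UnitScaleTiltHistoryTailChessboardT3
import Summits.QuantumFields.YangMills.Theorems.CoarseStiffnessTailHistoryTailOfStiffness
import Summits.QuantumFields.YangMills.Theorems.LocalInsertionExpMomentSU2TorusUniformT3
import HarnessLib

/-!
# LINE 29 «CombPeierls» — stub (P) `stub_uniformPlaquetteTail` PROVED: the β-UNIFORM, volume-uniform, prefactor-free
# single-plaquette sub-Gaussian tail (and first moment) of the level-`K` Wilson–Gibbs law `gibbsK` on Bałaban's three-tori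

Seat `ym-line-cst-p1` (g33), `--supports stmt-QuantumFields-23532` (`PoincareLipschitz.MesoscopicConcentrationL`, K1′; skeleton
`Cruxes/HistoryTailL/Lines/comb_peierls.lean` of ideator `ym-r3-idea-2` g16, registered 2026-08-29T18:52Z).  The theorem below is the
registered stub TOKEN FOR TOKEN: for every block size `L` there are `C₀ ≥ 0`, `κ₀ > 0`, `K₁ ≥ 0`, `γ₁ ∈ (0,1]` (here `κ₀ = 1/8`, `γ₁ = 1`,
`C₀ = exp(9000·L³·E)`, `K₁ = C₀·√(8π)/2`) such that for every family `F` (`F.L = L`), every `0 < γ ≤ γ₁`, every cut-off `K` and every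
finest plaquette `p`:
* `μ_K{s ≤ dist₁(U(∂p))} ≤ C₀·exp(−κ₀·β_K·s²)` for ALL `s ≥ 0` — NO power of `β_K = (γL^{−K})⁻¹` in front, NO volume factor;
* `∫ dist₁(U(∂p)) dμ_K ≤ K₁/√β_K`.

THE ARGUMENT (unconditional; three landed inputs).
1. THE GLOBAL EXPONENTIAL MOMENT WITHOUT SLACK (this seat, g15): ✓`CoarseStiffnessTailUniformMeanAction.exists_bareStiffness_le` —
   one absolute `E ≥ 0` with `∫ exp(c₀·β_K·Σ_a dist₁(U(∂a))²) dμ_K ≤ exp(E·#Plaq_0)` for all `F`, `0 < γ ≤ 1`, `K`, `0 ≤ c₀ ≤ 1/8`.  Behind it: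
   the EXACT Laplace exponent of the torus partition function on both sides (`log_partitionFn_le_exact` / `log_partitionFn_ge_exact`:
   `log Z_P(β) = −(3|T|−1)·log β + O(|T|)`, the lower bound through the `β^{−1/2}`-tube around almost-commuting triples), whence the RATIO
   `log Z_P(β′) − log Z_P(β) ≤ E·|T|` for `1 ≤ β ≤ 2β′` with NO `log β` — the two-sided free-energy sandwich the line's card asks for, uniform in
   the volume AND the coupling (no residual `β^{c/L}`).
2. CHESSBOARD (✓`HistoryTailChessboardT3.chessboardRP_T3`, [FrohlichIsraelLiebSimon1978] Thm 4.1, at height `j = 0`, separation `ρ = 1`):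
   `μ_K(A_p) ≤ μ_K(⋂_{q ∈ S} A_q)^{1/|S|}` for a family `S ∋ p` with `(sites per direction)³ ≤ |S|·8(5L)³`, hence `#Plaq_0 ≤ 9000·L³·|S|`
   (✓`CoarseStiffnessTailHistoryTailOfStiffness.card_plaq_le_of_chessboard`).
3. EXPONENTIAL CHEBYSHEV on the joint event (`⋂_q A_q ⊆ {|S|·s² ≤ Σ_a dist₁²}`, the other summands are `≥ 0`; Mathlib
   `measure_ge_le_exp_mul_mgf` at `t = β_K/8`): `μ_K(⋂_q A_q) ≤ e^{−β_K|S|s²/8}·e^{E·#Plaq_0}`; the `1/|S|`-th root is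
   `exp(−β_K s²/8 + E·#Plaq_0/|S|) ≤ e^{9000L³E}·e^{−β_K s²/8}`.
4. The first moment by Cavalieri against the Gaussian tail (✓`LocalInsertion.ExpMomentSU2UniformT3.integral_le_of_gaussian_tail`,
   `∫_0^∞ e^{−ct²}dt = √(π/c)/2` at `c = β_K/8`): `∫ dist₁ ≤ C₀·√(8π/β_K)/2 = K₁/√β_K`.
Compared with the tree's earlier tails: ✓`T3FinestHeightTail.gibbsMeasure_real_dist1_ge_le` carries `√β^{9}` (link-ball denominator);
✓`LocalInsertion.ExpMomentSU2UniformT3.exists_gibbsK_real_dist1_ge_le_uniform` is prefactor-free but CONDITIONAL on the one-site doubling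
`hONE`; ✓`PlaquetteExpMoment.measureReal_largePlaquette_le_of_sandwich` keeps the sandwich displayed.  Here nothing is assumed.

HONEST SCOPE.  A level-0 (un-averaged) statement about the bare Wilson law; pure measure theory over three landed theorems.  Nothing of
the line's other stubs ((D) comb transfer, (B) bookkeeping, (R) the mesoscopic residual), of `MesoscopicConcentrationL` (23532),
`HistoryTailL` (19936) or of rung R3 (`YM3TorusSU2`, a RECORD rung — not d = 4, not infinite volume, not a mass gap, not Clay) is proved.

References: J. Fröhlich, R. Israel, E. H. Lieb, B. Simon, CMP **62** (1978) 1–34 [FrohlichIsraelLiebSimon1978] (Thm 4.1);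
T. Bałaban, CMP **102** (1985) 255–275 [Balaban1985UV3] ((5) p.256, (11) p.258); S. Chatterjee, J. Funct. Anal. **271** (2016)
2944–3005 [Chatterjee2016] (Thm 2.1 — the free-energy leading term; here replaced by the exact torus exponent of input 1).
-/

noncomputable section

namespace Summit.QuantumFields.YangMills.Theorems.PoincareLipschitzMesoscopicConcentrationLUniformPlaquetteTail

open MeasureTheory ProbabilityTheory Finset
open Literature.MathematicalPhysics.QuantumFieldTheory
open Literature.MathematicalPhysics.QuantumFieldTheory.Balaban1983to89
open Literature.MathematicalPhysics.QuantumFieldTheory.Balaban1983to89.T3ContinuumYM3Torus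
open Literature.MathematicalPhysics.QuantumFieldTheory.Balaban1983to89.T3UnitScaleTilt
open Literature.MathematicalPhysics.QuantumFieldTheory.Balaban1983to89.T3UnitLawDensityEML (ℰp)
open Summit.QuantumFields.YangMills.Theorems.HistoryTailChessboardT3 (chessboardRP_T3)
open Summit.QuantumFields.YangMills.Theorems.CoarseStiffnessTailPressureConvexity (sqSum_mem measurable_sqSum measurable_dist1_plaqHol)
open Summit.QuantumFields.YangMills.Theorems.CoarseStiffnessTailUniformMeanAction (exists_bareStiffness_le)
open Summit.QuantumFields.YangMills.Theorems.CoarseStiffnessTailHistoryTailOfStiffness (card_plaq_le_of_chessboard)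
open Summit.QuantumFields.YangMills.Theorems.LocalInsertion.ExpMomentSU2UniformT3 (integral_le_of_gaussian_tail)

/-! ## §1 The prefactor-free tail for one family, one coupling, one cut-off -/

section OneFamily

variable (F : T3Family)

/-- On the joint event `{∀ q ∈ S, s ≤ dist₁(U(∂q))}` (`0 ≤ s`) the bare square sum is at least `|S|·s²` (the other summands are `≥ 0`).
[folklore] -/
theorem card_mul_sq_le_sqSum (K : ℕ) {s : ℝ} (hs : 0 ≤ s) (S : Finset (Plaq (F.P K) 0))
    (U : GaugeField (F.P K) 0 (Matrix.specialUnitaryGroup (Fin 2) ℂ))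
    (hU : ∀ q ∈ S, s ≤ GaugeGroup.dist1 (GaugeField.plaqHol U q)) :
    (S.card : ℝ) * s ^ 2 ≤ ∑ a : Plaq (F.P K) 0, GaugeGroup.dist1 (GaugeField.plaqHol U a) ^ 2 := by
  calc (S.card : ℝ) * s ^ 2 = ∑ _q ∈ S, s ^ 2 := by rw [Finset.sum_const, nsmul_eq_mul]
    _ ≤ ∑ q ∈ S, GaugeGroup.dist1 (GaugeField.plaqHol U q) ^ 2 :=
        Finset.sum_le_sum fun q hq => pow_le_pow_left₀ hs (hU q hq) 2
    _ ≤ ∑ a : Plaq (F.P K) 0, GaugeGroup.dist1 (GaugeField.plaqHol U a) ^ 2 :=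
        Finset.sum_le_sum_of_subset_of_nonneg (Finset.subset_univ S) fun a _ _ => sq_nonneg _

/-- **THE PREFACTOR-FREE TAIL AT ONE `(F, γ, K)`**: if `∫ exp(β_K/8·Σ_a dist₁(U(∂a))²) dμ_K ≤ exp(E·#Plaq_0)` with `E ≥ 0`, then for every
finest plaquette `p` and every `s ≥ 0`: `μ_K{s ≤ dist₁(U(∂p))} ≤ exp(9000·L³·E)·exp(−β_K s²/8)` — chessboard at height `0` + exponential
Chebyshev on the joint event. [cite: FrohlichIsraelLiebSimon1978, Thm 4.1] -/
theorem tail_of_expMoment {γ E : ℝ} (hγ : 0 < γ) (hγ1 : γ ≤ 1) (hE : 0 ≤ E) (K : ℕ)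
    (hX : ∫ U, Real.exp (1 / 8 * (γ * ((F.L : ℝ)⁻¹) ^ K)⁻¹ *
        ∑ a : Plaq (F.P K) 0, GaugeGroup.dist1 (GaugeField.plaqHol U a) ^ 2) ∂(gibbsK F ℰp γ K) ≤
      Real.exp (E * (Fintype.card (Plaq (F.P K) 0) : ℝ)))
    (p : Plaq (F.P K) 0) {s : ℝ} (hs : 0 ≤ s) :
    (gibbsK F ℰp γ K).real {U | s ≤ GaugeGroup.dist1 (GaugeField.plaqHol U p)} ≤
      Real.exp (9000 * (F.L : ℝ) ^ 3 * E) * Real.exp (-(1 / 8 * (F.scheme ℰp γ).β K * s ^ 2)) := by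
  haveI := isProbabilityMeasure_gibbsK F ℰp hγ.le K
  have hL1 : 1 < F.L := F.hL.2
  set β : ℝ := (γ * ((F.L : ℝ)⁻¹) ^ K)⁻¹ with hβdef
  have hβ0 : 0 < β := by
    rw [hβdef]
    have hL0 : (0 : ℝ) < F.L := by exact_mod_cast (zero_lt_one.trans hL1)
    exact inv_pos.mpr (mul_pos hγ (pow_pos (inv_pos.mpr hL0) _))
  have hβeq : (F.scheme ℰp γ).β K = β := rfl
  -- the bare square sum
  set X : GaugeField (F.P K) 0 (Matrix.specialUnitaryGroup (Fin 2) ℂ) → ℝ := fun U =>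
    ∑ a : Plaq (F.P K) 0, GaugeGroup.dist1 (GaugeField.plaqHol U a) ^ 2 with hXdef
  -- the chessboard family at height `0`, separation `ρ = 1`
  obtain ⟨S, hpS, -, hcount, hchess⟩ :=
    chessboardRP_T3 F.L F.hL.1 hL1 F γ rfl hγ hγ1 s K 0 (Nat.zero_le K) 1 le_rfl p
  have hS0 : 0 < S.card := Finset.card_pos.mpr ⟨p, hpS⟩
  have hS0R : (0 : ℝ) < (S.card : ℝ) := by exact_mod_cast hS0
  -- at height `0` the averaged field is the field itself (`Averaging.iter _ 0 U = U`, definitionally)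
  have hchess0 : (gibbsK F ℰp γ K).real {U | s ≤ GaugeGroup.dist1 (GaugeField.plaqHol U p)} ≤
      ((gibbsK F ℰp γ K).real {U | ∀ q ∈ S, s ≤ GaugeGroup.dist1 (GaugeField.plaqHol U q)}) ^
        ((1 : ℝ) / (S.card : ℝ)) := hchess
  -- the joint event lies in `{|S|s² ≤ X}`
  have hsub : {U : GaugeField (F.P K) 0 (Matrix.specialUnitaryGroup (Fin 2) ℂ) |
        ∀ q ∈ S, s ≤ GaugeGroup.dist1 (GaugeField.plaqHol U q)} ⊆ {U | (S.card : ℝ) * s ^ 2 ≤ X U} := fun U hU =>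
    card_mul_sq_le_sqSum F K hs S U hU
  -- integrability of `exp(t X)`, `t = β/8`
  set t : ℝ := 1 / 8 * β with htdef
  have ht0 : 0 ≤ t := by positivity
  have hint : Integrable (fun U => Real.exp (t * X U)) (gibbsK F ℰp γ K) := by
    have hmeas : Measurable fun U => Real.exp (t * X U) :=
      Real.measurable_exp.comp ((measurable_sqSum F K).const_mul t)
    refine (integrable_const (Real.exp (t * (4 * (Fintype.card (Plaq (F.P K) 0) : ℝ))))).mono'
      hmeas.aestronglyMeasurable (ae_of_all _ fun U => ?_)
    rw [Real.norm_eq_abs, abs_of_pos (Real.exp_pos _)]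
    exact Real.exp_le_exp.mpr (mul_le_mul_of_nonneg_left (sqSum_mem F U).2 ht0)
  -- exponential Chebyshev on the joint event
  have hmgf : mgf X (gibbsK F ℰp γ K) t ≤ Real.exp (E * (Fintype.card (Plaq (F.P K) 0) : ℝ)) := by
    simp only [mgf]
    convert hX using 4
  have hjoint : (gibbsK F ℰp γ K).real {U | ∀ q ∈ S, s ≤ GaugeGroup.dist1 (GaugeField.plaqHol U q)} ≤
      Real.exp (-t * ((S.card : ℝ) * s ^ 2)) * Real.exp (E * (Fintype.card (Plaq (F.P K) 0) : ℝ)) := by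
    refine (measureReal_mono hsub).trans ?_
    refine (measure_ge_le_exp_mul_mgf ((S.card : ℝ) * s ^ 2) ht0 hint).trans ?_
    exact mul_le_mul_of_nonneg_left hmgf (Real.exp_pos _).le
  -- take the `1/|S|`-th power
  have hbase0 : 0 ≤ (gibbsK F ℰp γ K).real {U | ∀ q ∈ S, s ≤ GaugeGroup.dist1 (GaugeField.plaqHol U q)} :=
    measureReal_nonneg
  have hexpS : 0 ≤ (1 : ℝ) / (S.card : ℝ) := by positivity
  have hpow := Real.rpow_le_rpow hbase0 hjoint hexpS
  have hrhs : (Real.exp (-t * ((S.card : ℝ) * s ^ 2)) * Real.exp (E * (Fintype.card (Plaq (F.P K) 0) : ℝ))) ^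
        ((1 : ℝ) / (S.card : ℝ)) =
      Real.exp (-(t * s ^ 2) + E * (Fintype.card (Plaq (F.P K) 0) : ℝ) / (S.card : ℝ)) := by
    rw [← Real.exp_add, ← Real.exp_mul]
    congr 1
    field_simp
  rw [hrhs] at hpow
  refine (hchess0.trans hpow).trans ?_
  -- the constants: `E #Plaq_0 / |S| ≤ 9000 L³ E` and `t s² = β s²/8`
  have hcard : (Fintype.card (Plaq (F.P K) 0) : ℝ) ≤ 9000 * (F.L : ℝ) ^ 3 * (S.card : ℝ) :=
    card_plaq_le_of_chessboard F K 0 hcount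
  have hC : E * (Fintype.card (Plaq (F.P K) 0) : ℝ) / (S.card : ℝ) ≤ 9000 * (F.L : ℝ) ^ 3 * E := by
    rw [div_le_iff₀ hS0R]
    have h2 : E * (Fintype.card (Plaq (F.P K) 0) : ℝ) ≤ E * (9000 * (F.L : ℝ) ^ 3 * (S.card : ℝ)) :=
      mul_le_mul_of_nonneg_left hcard hE
    nlinarith
  have hts : t * s ^ 2 = 1 / 8 * (F.scheme ℰp γ).β K * s ^ 2 := by rw [htdef, hβeq]
  rw [← Real.exp_add, hts]
  exact Real.exp_le_exp.mpr (by linarith)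

end OneFamily

/-! ## §2 The registered stub BY NAME AND SIGNATURE -/

/-- **stub_uniformPlaquetteTail (LINE 29 «CombPeierls», stub (P)), PROVED — token-identical with the registered stub of
`Cruxes/HistoryTailL/Lines/comb_peierls.lean` (crux stmt-QuantumFields-23532).**  β-UNIFORM single-plaquette sub-Gaussian tail and first
moment under the level-`K` Wilson–Gibbs law `gibbsK`: for each `L` there are `C₀ ≥ 0`, `κ₀ > 0`, `K₁ ≥ 0`, `γ₁ ∈ (0,1]` with
`μ_K{s ≤ dist₁(U(∂p))} ≤ C₀·exp(−κ₀·β_K·s²)` for all `s ≥ 0` and `∫ dist₁(U(∂p)) dμ_K ≤ K₁/√β_K`, for every family (`F.L = L`), `0 < γ ≤ γ₁`,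
level `K` and plaquette `p` — NO power of `β_K` in front.  Constants: `κ₀ = 1/8`, `γ₁ = 1`, `C₀ = exp(9000L³E)` with `E` the absolute
constant of ✓`exists_bareStiffness_le` (exact two-sided torus free energy, this seat g15), `K₁ = C₀·√(π/(1/8))/2`.  Proof: `tail_of_expMoment`
(chessboard + exponential Chebyshev against the slack-free global exponential moment) and Cavalieri (`integral_le_of_gaussian_tail`).
[cite: FrohlichIsraelLiebSimon1978, Thm 4.1; Balaban1985UV3, (11) p.258; Chatterjee2016, Thm 2.1] -/
theorem stub_uniformPlaquetteTail :
    ∀ (L : ℕ), ∃ (C₀ κ₀ K₁ : ℝ), 0 ≤ C₀ ∧ 0 < κ₀ ∧ 0 ≤ K₁ ∧ ∃ γ₁ : ℝ, 0 < γ₁ ∧ γ₁ ≤ 1 ∧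
      ∀ (F : T3Family) (γ : ℝ), F.L = L → 0 < γ → γ ≤ γ₁ → ∀ (K : ℕ) (p : Plaq (F.P K) 0),
        (∀ s : ℝ, 0 ≤ s →
          (gibbsK F ℰp γ K).real {U | s ≤ GaugeGroup.dist1 (GaugeField.plaqHol U p)}
            ≤ C₀ * Real.exp (-(κ₀ * (F.scheme ℰp γ).β K * s ^ 2))) ∧
        ∫ U, GaugeGroup.dist1 (GaugeField.plaqHol U p) ∂(gibbsK F ℰp γ K) ≤ K₁ / Real.sqrt ((F.scheme ℰp γ).β K) := by
  intro L
  obtain ⟨E, hE0, hE⟩ := exists_bareStiffness_le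
  refine ⟨Real.exp (9000 * (L : ℝ) ^ 3 * E), 1 / 8,
    Real.exp (9000 * (L : ℝ) ^ 3 * E) * (Real.sqrt (Real.pi / (1 / 8)) / 2),
    (Real.exp_pos _).le, by norm_num, by positivity, 1, one_pos, le_rfl, fun F γ hFL hγ hγ1 K p => ?_⟩
  subst hFL
  haveI := isProbabilityMeasure_gibbsK F ℰp hγ.le K
  have hL1 : 1 < F.L := F.hL.2
  -- the coupling `β_K`
  set β : ℝ := (γ * ((F.L : ℝ)⁻¹) ^ K)⁻¹ with hβdef
  have hβ0 : 0 < β := by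
    rw [hβdef]
    have hL0 : (0 : ℝ) < F.L := by exact_mod_cast (zero_lt_one.trans hL1)
    exact inv_pos.mpr (mul_pos hγ (pow_pos (inv_pos.mpr hL0) _))
  have hβeq : (F.scheme ℰp γ).β K = β := rfl
  -- the slack-free global exponential moment at `c₀ = 1/8`
  have hX := hE F γ hγ hγ1 K (1 / 8) (by norm_num) le_rfl
  -- (i) the tail
  have htail : ∀ s : ℝ, 0 ≤ s →
      (gibbsK F ℰp γ K).real {U | s ≤ GaugeGroup.dist1 (GaugeField.plaqHol U p)} ≤
        Real.exp (9000 * (F.L : ℝ) ^ 3 * E) * Real.exp (-(1 / 8 * (F.scheme ℰp γ).β K * s ^ 2)) := fun s hs =>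
    tail_of_expMoment F hγ hγ1 hE0 K hX p hs
  refine ⟨htail, ?_⟩
  -- (ii) the first moment by Cavalieri against the Gaussian tail
  have hc : 0 < 1 / 8 * β := by positivity
  have htail' : ∀ θ : ℝ, 0 < θ →
      (gibbsK F ℰp γ K).real {U | θ < GaugeGroup.dist1 (GaugeField.plaqHol U p)} ≤
        Real.exp (9000 * (F.L : ℝ) ^ 3 * E) * Real.exp (-(1 / 8 * β) * θ ^ 2) := by
    intro θ hθ
    have hsub : {U : GaugeField (F.P K) 0 (Matrix.specialUnitaryGroup (Fin 2) ℂ) |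
        θ < GaugeGroup.dist1 (GaugeField.plaqHol U p)} ⊆ {U | θ ≤ GaugeGroup.dist1 (GaugeField.plaqHol U p)} :=
      fun U hU => le_of_lt (α := ℝ) hU
    refine (measureReal_mono hsub).trans ?_
    have h := htail θ hθ.le
    rw [hβeq] at h
    calc (gibbsK F ℰp γ K).real {U | θ ≤ GaugeGroup.dist1 (GaugeField.plaqHol U p)}
        ≤ Real.exp (9000 * (F.L : ℝ) ^ 3 * E) * Real.exp (-(1 / 8 * β * θ ^ 2)) := h
      _ = Real.exp (9000 * (F.L : ℝ) ^ 3 * E) * Real.exp (-(1 / 8 * β) * θ ^ 2) := by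
          congr 2; ring
  have hmom := integral_le_of_gaussian_tail (μ := gibbsK F ℰp γ K)
    (f := fun U : GaugeField (F.P K) 0 (Matrix.specialUnitaryGroup (Fin 2) ℂ) => GaugeGroup.dist1 (GaugeField.plaqHol U p))
    (fun U => GaugeGroup.dist1_nonneg _) (Real.exp_pos _).le hc htail'
  refine hmom.trans (le_of_eq ?_)
  -- `C₀·√(π/(β/8))/2 = (C₀·√(8π)/2)/√β`
  rw [hβeq]
  have hsq : Real.sqrt (Real.pi / (1 / 8 * β)) = Real.sqrt (Real.pi / (1 / 8)) / Real.sqrt β := by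
    rw [← div_div, Real.sqrt_div' _ hβ0.le]
  rw [hsq]
  ring

end Summit.QuantumFields.YangMills.Theorems.PoincareLipschitzMesoscopicConcentrationLUniformPlaquetteTail

end
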